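import Summits.CriticalPhenomena.PercolationContinuityZ3.Theorems.QuantitativeBGN.Negative.LoadBearing
import Literature.Probability.Percolation.Crossings
import Mathlib.Analysis.SpecialFunctions.Pow.Real
import Mathlib.Analysis.Complex.Exponential
import HarnessLib

/-!
# `QuantitativeBGN` (stmt-CriticalPhenomena-0913) — supercritical descent: the crux from two statements above `p_c`

Crux `Summit.CriticalPhenomena.PercolationContinuityZ3.Theses.PercLowPointHalfSpace.QuantitativeBGN`
(`∃ a C, 0 < a ∧ ∀ r ≥ 1, P_{p_c(ℤ³)}(arm_H(0,r)) ≤ C r^{-a}`), crux idea `supercritical-descent`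
(`Cruxes/QuantitativeBGN/Ideas/supercritical-descent.md`, lead c5). For every `p > p_c` the arm event is
increasing and splits on `{0 ↔ ∞ in H}`:

  `π_s(r; p_c) ≤ π_s(r; p) ≤ θ_H(p) + P_p(arm_H(0,r) ∖ {0 ↔ ∞ in H})`      (`armH_real_le_descent`),

so the crux follows (`quantitativeBGN_of_descent`, choosing `p = p_c + r^{-1/(2B)}`) from
* (D1) a HÖLDER MODULUS for BGN's continuity: `θ_H(p) ≤ C₁ (p − p_c)^b` for `p_c < p ≤ p_c + δ₀`, and
* (D2) QUANTITATIVE SUPERCRITICAL SHARPNESS IN `H`: `P_p(arm_H(0,r) ∖ {0 ↔ ∞ in H}) ≤ C₂ exp(−c r (p − p_c)^B)` for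
  `p_c < p ≤ p_c + δ₀`, `r ≥ 1` — finite supercritical half-space clusters are short on the scale `(p−p_c)^{-B}`.
Both hypotheses are spelled out over the tree's `theta (halfSpaceGraph 3) (halfSpaceOrigin 3)`, `armH`,
`percolatesVia`; nothing here is unconditional news about the crux ((D1) is implied by the crux, (D2) is the
quantitative Grimmett–Marstrand problem in `H`, open).
-/

noncomputable section

namespace Summit.CriticalPhenomena.PercolationContinuityZ3.Theorems

open MeasureTheory Literature.Probability.Percolation Literature.Probability.LatticeModels
open Summit.CriticalPhenomena.PercolationContinuityZ3.Theorems.QuantitativeBGN.Negative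
  (armH QuantitativeBGNAt quantitativeBGN_iff theta_halfSpace_le_armH measurableSet_armH)
open scoped ENNReal

namespace Descent

/-- `arm_H(0,r)` is increasing (a union of the increasing events `{0 ⟷ y in H}`). [folklore] -/
theorem isUpperSet_armH (r : ℕ) : IsUpperSet (armH r) := by
  intro ω ω' hle hω
  obtain ⟨y, hy, hconn⟩ := hω
  exact ⟨y, hy, isUpperSet_openConnIn _ 0 y hle hconn⟩

/-- Monotonicity in `p`: `P_p(arm_H(0,r)) ≤ P_q(arm_H(0,r))` for `p ≤ q`. [folklore] -/
theorem armH_real_mono {p q : unitInterval} (hpq : p ≤ q) (r : ℕ) :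
    (bondPercolation (zdGraph 3) p).real (armH r) ≤ (bondPercolation (zdGraph 3) q).real (armH r) :=
  DCT16.real_mono_of_isUpperSet (zdGraph 3) (isUpperSet_armH r) (measurableSet_armH r) hpq

/-- **The descent inequality**: for `p_c ≤ p` (indeed any `p' ≤ p`),
`P_{p'}(arm_H(0,r)) ≤ θ_H(p) + P_p(arm_H(0,r) ∖ {0 ↔ ∞ in H})`. [folklore] -/
theorem armH_real_le_descent {p' p : unitInterval} (hpq : p' ≤ p) (r : ℕ) :
    (bondPercolation (zdGraph 3) p').real (armH r) ≤
      theta (halfSpaceGraph 3) (halfSpaceOrigin 3) p +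
        (bondPercolation (zdGraph 3) p).real
          (armH r \ percolatesVia (withinGraph (zdGraph 3) {x : Site 3 | 0 ≤ x 0}) 0) := by
  set PV := percolatesVia (withinGraph (zdGraph 3) {x : Site 3 | 0 ≤ x 0}) (0 : Site 3) with hPV
  have hsplit : armH r ⊆ PV ∪ (armH r \ PV) := by
    intro ω hω
    by_cases h : ω ∈ PV
    · exact Or.inl h
    · exact Or.inr ⟨hω, h⟩
  calc (bondPercolation (zdGraph 3) p').real (armH r)
      ≤ (bondPercolation (zdGraph 3) p).real (armH r) := armH_real_mono hpq r
    _ ≤ (bondPercolation (zdGraph 3) p).real PV + (bondPercolation (zdGraph 3) p).real (armH r \ PV) :=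
        (measureReal_mono hsplit).trans (measureReal_union_le _ _)
    _ = _ := by rw [BGNd.theta_halfSpace_eq_real_percolatesVia]; rfl

end Descent

open Descent

/-- **The crux from supercritical descent.** If, for `p` slightly above `p_c = p_c(ℤ³)`,
(D1) `θ_H(p) ≤ C₁ (p − p_c)^b` (a Hölder modulus for Barsky–Grimmett–Newman's `θ_H(p_c) = 0`) and
(D2) `P_p(arm_H(0,r) ∖ {0 ↔ ∞ in H}) ≤ C₂ exp(−c r (p − p_c)^B)` (finite supercritical half-space clusters are short on
the scale `(p − p_c)^{-B}`), then `QuantitativeBGN` holds with exponent `a = b/(2B)`: take `p = p_c + r^{-1/(2B)}` in the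
descent inequality `π_s(r;p_c) ≤ θ_H(p) + P_p(arm_H(0,r) ∖ {0 ↔ ∞ in H})`, so that `θ_H(p) ≤ C₁ r^{-a}` and the finite-cluster
term is `≤ C₂ e^{-c√r} ≤ C₂ n! c^{-n} r^{-a}` (`n = ⌈2a⌉`); the finitely many `r < δ₀^{-2B}` are absorbed in the constant.
[folklore] -/
theorem Descent.quantitativeBGN_of_descent'
    (hD1 : ∃ b C δ₀ : ℝ, 0 < b ∧ 0 < δ₀ ∧ ∀ p : unitInterval, criticalProb (zdGraph 3) (0 : Site 3) < (p : ℝ) →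
      (p : ℝ) ≤ criticalProb (zdGraph 3) (0 : Site 3) + δ₀ →
        theta (halfSpaceGraph 3) (halfSpaceOrigin 3) p ≤ C * ((p : ℝ) - criticalProb (zdGraph 3) (0 : Site 3)) ^ b)
    (hD2 : ∃ B C c δ₀ : ℝ, 0 < B ∧ 0 < c ∧ 0 < δ₀ ∧ ∀ p : unitInterval, criticalProb (zdGraph 3) (0 : Site 3) < (p : ℝ) →
      (p : ℝ) ≤ criticalProb (zdGraph 3) (0 : Site 3) + δ₀ → ∀ r : ℕ, 1 ≤ r →
        (bondPercolation (zdGraph 3) p).real (armH r \ percolatesVia (withinGraph (zdGraph 3) {x : Site 3 | 0 ≤ x 0}) 0) ≤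
          C * Real.exp (-(c * r * ((p : ℝ) - criticalProb (zdGraph 3) (0 : Site 3)) ^ B)))
    : Summit.CriticalPhenomena.PercolationContinuityZ3.Theses.PercLowPointHalfSpace.QuantitativeBGN := by
  obtain ⟨b, C₁, δ₁, hb, hδ₁, h1⟩ := hD1
  obtain ⟨B, C₂, c, δ₂, hB, hc, hδ₂, h2⟩ := hD2
  set p₀ : ℝ := criticalProb (zdGraph 3) (0 : Site 3) with hp₀
  have hp₀0 : 0 < p₀ := criticalProb_zd_pos 3 (by norm_num)
  have hp₀1 : p₀ < 1 := criticalProb_zd_lt_one (by norm_num)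
  -- exponents and thresholds
  set a : ℝ := b / (2 * B) with ha
  have ha0 : 0 < a := div_pos hb (by linarith)
  set n : ℕ := ⌈2 * a⌉₊ with hn
  have hna : a ≤ (n : ℝ) / 2 := by
    have := Nat.le_ceil (2 * a)
    rw [← hn] at this
    linarith
  set δ₀ : ℝ := min (min δ₁ δ₂) ((1 - p₀) / 2) with hδ₀
  have hδ₀pos : 0 < δ₀ := lt_min (lt_min hδ₁ hδ₂) (by linarith)
  have hδ₀le₁ : δ₀ ≤ δ₁ := (min_le_left _ _).trans (min_le_left _ _)
  have hδ₀le₂ : δ₀ ≤ δ₂ := (min_le_left _ _).trans (min_le_right _ _)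
  have hδ₀le : δ₀ ≤ (1 - p₀) / 2 := min_le_right _ _
  set R₀ : ℝ := δ₀ ^ (-(2 * B)) with hR₀
  have hR₀pos : 0 < R₀ := Real.rpow_pos_of_pos hδ₀pos _
  set K : ℝ := (n.factorial : ℝ) / c ^ n with hK
  have hK0 : 0 ≤ K := div_nonneg (by positivity) (pow_nonneg hc.le n)
  refine quantitativeBGN_iff.2 ⟨a, max C₁ 0 + max C₂ 0 * K + R₀ ^ a, ha0, fun r hr => ?_⟩
  have hr0 : (0 : ℝ) < r := by exact_mod_cast hr
  have hr1 : (1 : ℝ) ≤ r := by exact_mod_cast hr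
  have hra : 0 < (r : ℝ) ^ (-a) := Real.rpow_pos_of_pos hr0 _
  set δ : ℝ := (r : ℝ) ^ (-(1 / (2 * B))) with hδ
  have hδpos : 0 < δ := Real.rpow_pos_of_pos hr0 _
  by_cases hcase : δ ≤ δ₀
  · -- large `r`: work at `p = p_c + δ`
    have hp_mem : p₀ + δ ∈ Set.Icc (0 : ℝ) 1 := ⟨by linarith, by linarith⟩
    set p : unitInterval := ⟨p₀ + δ, hp_mem⟩ with hpdef
    have hpcoe : (p : ℝ) = p₀ + δ := rfl
    have hpc_le : criticalProbI 3 ≤ p := by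
      change ((criticalProbI 3 : unitInterval) : ℝ) ≤ (p : ℝ)
      rw [coe_criticalProbI, hpcoe]; linarith
    have hp_gt : p₀ < (p : ℝ) := by rw [hpcoe]; linarith
    have hp_le₁ : (p : ℝ) ≤ p₀ + δ₁ := by rw [hpcoe]; linarith
    have hp_le₂ : (p : ℝ) ≤ p₀ + δ₂ := by rw [hpcoe]; linarith
    have hsub : (p : ℝ) - p₀ = δ := by rw [hpcoe]; ring
    -- the two terms
    have hθ : theta (halfSpaceGraph 3) (halfSpaceOrigin 3) p ≤ max C₁ 0 * (r : ℝ) ^ (-a) := by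
      have := h1 p hp_gt hp_le₁
      rw [hsub] at this
      have hδb : δ ^ b = (r : ℝ) ^ (-a) := by
        rw [hδ, ← Real.rpow_mul hr0.le]; congr 1; rw [ha]; field_simp
      calc theta (halfSpaceGraph 3) (halfSpaceOrigin 3) p ≤ C₁ * δ ^ b := this
        _ ≤ max C₁ 0 * δ ^ b := mul_le_mul_of_nonneg_right (le_max_left _ _) (Real.rpow_nonneg hδpos.le _)
        _ = max C₁ 0 * (r : ℝ) ^ (-a) := by rw [hδb]
    have hfin : (bondPercolation (zdGraph 3) p).real
        (armH r \ percolatesVia (withinGraph (zdGraph 3) {x : Site 3 | 0 ≤ x 0}) 0) ≤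
          max C₂ 0 * K * (r : ℝ) ^ (-a) := by
      have := h2 p hp_gt hp_le₂ r hr
      rw [hsub] at this
      -- `δ^B = r^{-1/2}`, so the exponent is `c r^{1/2}`
      have hδB : δ ^ B = (r : ℝ) ^ (-(1 / 2 : ℝ)) := by
        rw [hδ, ← Real.rpow_mul hr0.le]; congr 1; field_simp
      have hx : c * r * δ ^ B = c * (r : ℝ) ^ ((1 : ℝ) / 2) := by
        rw [hδB, mul_assoc, ← Real.rpow_one_add' hr0.le (by norm_num)]
        norm_num
      have hxpos : 0 < c * (r : ℝ) ^ ((1 : ℝ) / 2) := mul_pos hc (Real.rpow_pos_of_pos hr0 _)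
      -- `e^{-x} ≤ n!/x^n` for `x > 0` (from `x^n/n! ≤ e^x`; cf. `Iwaniec1980b.exp_neg_le_factorial_div_pow`)
      have hexn : ∀ {x : ℝ}, 0 < x → Real.exp (-x) ≤ (n.factorial : ℝ) / x ^ n := by
        intro x hx0
        have h := Real.pow_div_factorial_le_exp x hx0.le n
        have hxn : 0 < x ^ n := pow_pos hx0 n
        have hfac : (0 : ℝ) < n.factorial := by exact_mod_cast Nat.factorial_pos n
        rw [Real.exp_neg, inv_eq_one_div, div_le_div_iff₀ (Real.exp_pos x) hxn, one_mul]
        rw [div_le_iff₀ hfac] at h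
        linarith
      have hexp : Real.exp (-(c * r * δ ^ B)) ≤ K * (r : ℝ) ^ (-a) := by
        rw [hx]
        calc Real.exp (-(c * (r : ℝ) ^ ((1 : ℝ) / 2)))
            ≤ (n.factorial : ℝ) / (c * (r : ℝ) ^ ((1 : ℝ) / 2)) ^ n := hexn hxpos
          _ = K * (r : ℝ) ^ (-((n : ℝ) / 2)) := by
              rw [hK, mul_pow, ← Real.rpow_natCast ((r : ℝ) ^ ((1 : ℝ) / 2)) n, ← Real.rpow_mul hr0.le,
                Real.rpow_neg hr0.le, div_mul_eq_div_div, div_eq_mul_inv]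
              congr 2
              ring
          _ ≤ K * (r : ℝ) ^ (-a) :=
              mul_le_mul_of_nonneg_left (Real.rpow_le_rpow_of_exponent_le hr1 (by linarith)) hK0
      calc _ ≤ C₂ * Real.exp (-(c * r * δ ^ B)) := this
        _ ≤ max C₂ 0 * Real.exp (-(c * r * δ ^ B)) :=
            mul_le_mul_of_nonneg_right (le_max_left _ _) (Real.exp_pos _).le
        _ ≤ max C₂ 0 * (K * (r : ℝ) ^ (-a)) := mul_le_mul_of_nonneg_left hexp (le_max_right _ _)
        _ = max C₂ 0 * K * (r : ℝ) ^ (-a) := by ring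
    calc (bondPercolation (zdGraph 3) (criticalProbI 3)).real (armH r)
        ≤ theta (halfSpaceGraph 3) (halfSpaceOrigin 3) p +
            (bondPercolation (zdGraph 3) p).real
              (armH r \ percolatesVia (withinGraph (zdGraph 3) {x : Site 3 | 0 ≤ x 0}) 0) :=
          armH_real_le_descent hpc_le r
      _ ≤ max C₁ 0 * (r : ℝ) ^ (-a) + max C₂ 0 * K * (r : ℝ) ^ (-a) := add_le_add hθ hfin
      _ ≤ max C₁ 0 * (r : ℝ) ^ (-a) + max C₂ 0 * K * (r : ℝ) ^ (-a) + R₀ ^ a * (r : ℝ) ^ (-a) :=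
          le_add_of_nonneg_right (mul_nonneg (Real.rpow_nonneg hR₀pos.le _) hra.le)
      _ = (max C₁ 0 + max C₂ 0 * K + R₀ ^ a) * (r : ℝ) ^ (-a) := by ring
  · -- small `r < R₀`: the probability is at most `1 ≤ R₀^a r^{-a}`
    have hlt : δ₀ < δ := not_le.1 hcase
    have hrR : (r : ℝ) < R₀ := by
      -- `r = δ^{-2B}` and `t ↦ t^{-2B}` is decreasing
      have hrδ : (r : ℝ) = δ ^ (-(2 * B)) := by
        rw [hδ, ← Real.rpow_mul hr0.le]
        have : -(1 / (2 * B)) * -(2 * B) = 1 := by field_simp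
        rw [this, Real.rpow_one]
      rw [hrδ, hR₀]
      exact Real.rpow_lt_rpow_of_neg hδ₀pos hlt (by linarith)
    have h1le : (1 : ℝ) ≤ R₀ ^ a * (r : ℝ) ^ (-a) := by
      rw [Real.rpow_neg hr0.le, ← div_eq_mul_inv, le_div_iff₀ (Real.rpow_pos_of_pos hr0 _), one_mul]
      exact Real.rpow_le_rpow hr0.le hrR.le ha0.le
    calc (bondPercolation (zdGraph 3) (criticalProbI 3)).real (armH r) ≤ 1 := measureReal_le_one
      _ ≤ R₀ ^ a * (r : ℝ) ^ (-a) := h1le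
      _ ≤ (max C₁ 0 + max C₂ 0 * K + R₀ ^ a) * (r : ℝ) ^ (-a) := by
          have : 0 ≤ (max C₁ 0 + max C₂ 0 * K) * (r : ℝ) ^ (-a) :=
            mul_nonneg (add_nonneg (le_max_right _ _) (mul_nonneg (le_max_right _ _) hK0)) hra.le
          nlinarith

/-- **The crux from supercritical descent** (registered form of `Descent.quantitativeBGN_of_descent'`):
(D1) `θ_H(p) ≤ C₁ (p − p_c)^b` and (D2) `P_p(arm_H(0,r) ∖ {0 ↔ ∞ in H}) ≤ C₂ exp(−c r (p − p_c)^B)` for `p` slightly above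
`p_c(ℤ³)` imply `QuantitativeBGN` (exponent `b/(2B)`). [folklore] -/
theorem quantitativeBGN_of_descent : (∃ b C δ₀ : ℝ, 0 < b ∧ 0 < δ₀ ∧ ∀ p : unitInterval, criticalProb (zdGraph 3) (0 : Site 3) < (p : ℝ) → (p : ℝ) ≤ criticalProb (zdGraph 3) (0 : Site 3) + δ₀ → theta (halfSpaceGraph 3) (halfSpaceOrigin 3) p ≤ C * ((p : ℝ) - criticalProb (zdGraph 3) (0 : Site 3)) ^ b) → (∃ B C c δ₀ : ℝ, 0 < B ∧ 0 < c ∧ 0 < δ₀ ∧ ∀ p : unitInterval, criticalProb (zdGraph 3) (0 : Site 3) < (p : ℝ) → (p : ℝ) ≤ criticalProb (zdGraph 3) (0 : Site 3) + δ₀ → ∀ r : ℕ, 1 ≤ r → (bondPercolation (zdGraph 3) p).real (armH r \ percolatesVia (withinGraph (zdGraph 3) {x : Site 3 | 0 ≤ x 0}) 0) ≤ C * Real.exp (-(c * r * ((p : ℝ) - criticalProb (zdGraph 3) (0 : Site 3)) ^ B))) → Summit.CriticalPhenomena.PercolationContinuityZ3.Theses.PercLowPointHalfSpace.QuantitativeBGN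 :=
  fun hD1 hD2 => Descent.quantitativeBGN_of_descent' hD1 hD2

end Summit.CriticalPhenomena.PercolationContinuityZ3.Theorems

end
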